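import Mathlib
import HarnessLib

/-!
# `NoHeavyLowerTail` (stmt-CriticalPhenomena-4575) — the abstract ledger of a charging scheme (U1-PROOF §9) and the units identity (§2)

Support file (prover `prim-gen-swap` gen 13; `--supports stmt-CriticalPhenomena-4575`).  No definitions, no named facts, no sorries.

Two bookkeeping facts used by the assembly of the r-avoiding MWF supply inequality U1′_r (seat memos U1-PROOF.md §2/§9, LEAN-BLUEPRINT-U1.md §C):

* `StarSet.ledger_bound` — if units `u` (demand `w u`) are covered by charges `c u ρ` on resources `ρ` (capacity `cap ρ ≥ 0`), the units are sorted
  into families `fam u`, every family `k` loads a resource by at most `a k ρ · cap ρ`, and `Σ_k a k ρ ≤ 1` for every resource, then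
  `Σ_u w u ≤ Σ_ρ cap ρ` (the "ledger": U1-PROOF §9);
* `StarSet.config_sum_posPart_sub_cred` — for integer-valued `n ≥ 0` and `y ∈ {0,1}`:
  `Σ_S W S (n S − y S) = Σ_S W S (n S − y S)⁺ − Σ_{S : n S = 0 ∧ y S = 1} W S` (truncated subtraction in `ℕ` is the positive part; the last sum is the
  credit `Σ_{Cred} W` of U1-PROOF (★)).
-/

namespace Summit.CriticalPhenomena.PercolationContinuityZ3.Theorems

open Finset
open scoped BigOperators

namespace StarSet

/-- **The ledger of a charging scheme (U1-PROOF §9).**  Coverage of every unit, per-family load bounds and per-resource coefficient sums `≤ 1`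
give `Σ demand ≤ Σ capacity`. -/
theorem ledger_bound {υ ρ κ : Type*} [DecidableEq κ] (Us : Finset υ) (Rs : Finset ρ) (Ks : Finset κ)
    (w : υ → ℝ) (cap : ρ → ℝ) (hcap : ∀ r ∈ Rs, 0 ≤ cap r) (fam : υ → κ) (hfam : ∀ u ∈ Us, fam u ∈ Ks)
    (c : υ → ρ → ℝ) (a : κ → ρ → ℝ)
    (hcover : ∀ u ∈ Us, w u ≤ ∑ r ∈ Rs, c u r)
    (hload : ∀ k ∈ Ks, ∀ r ∈ Rs, ∑ u ∈ Us with fam u = k, c u r ≤ a k r * cap r)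
    (hledger : ∀ r ∈ Rs, ∑ k ∈ Ks, a k r ≤ 1) :
    ∑ u ∈ Us, w u ≤ ∑ r ∈ Rs, cap r := by
  classical
  calc ∑ u ∈ Us, w u ≤ ∑ u ∈ Us, ∑ r ∈ Rs, c u r := sum_le_sum hcover
    _ = ∑ r ∈ Rs, ∑ u ∈ Us, c u r := sum_comm
    _ = ∑ r ∈ Rs, ∑ k ∈ Ks, ∑ u ∈ Us with fam u = k, c u r := by
        refine sum_congr rfl fun r _ => ?_
        rw [sum_fiberwise_of_maps_to hfam]
    _ ≤ ∑ r ∈ Rs, ∑ k ∈ Ks, a k r * cap r := sum_le_sum fun r hr => sum_le_sum fun k hk => hload k hk r hr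
    _ = ∑ r ∈ Rs, (∑ k ∈ Ks, a k r) * cap r := by
        refine sum_congr rfl fun r _ => ?_
        rw [sum_mul]
    _ ≤ ∑ r ∈ Rs, 1 * cap r := sum_le_sum fun r hr => mul_le_mul_of_nonneg_right (hledger r hr) (hcap r hr)
    _ = ∑ r ∈ Rs, cap r := by simp

/-- **Units identity (U1-PROOF §2, (★)).**  With `n S ∈ ℕ` and `y S ≤ 1`:
`Σ_S W S·(n S − y S) = Σ_S W S·(n S − y S)⁺ − Σ_{S : n S = 0 ∧ y S = 1} W S`, the positive part being truncated subtraction in `ℕ`. -/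
theorem config_sum_posPart_sub_cred {σ : Type*} (PS : Finset σ) (W : σ → ℝ) (n y : σ → ℕ) (hy : ∀ S ∈ PS, y S ≤ 1) :
    ∑ S ∈ PS, W S * ((n S : ℝ) - (y S : ℝ)) =
      ∑ S ∈ PS, W S * ((n S - y S : ℕ) : ℝ) - ∑ S ∈ PS with (n S = 0 ∧ y S = 1), W S := by
  classical
  rw [sum_filter, ← sum_sub_distrib]
  refine sum_congr rfl fun S hS => ?_
  by_cases h : y S ≤ n S
  · rw [Nat.cast_sub h, if_neg (fun h' => by omega)]
    ring
  · have hyS := hy S hS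
    have hn : n S = 0 := by omega
    have hy1 : y S = 1 := by omega
    rw [if_pos ⟨hn, hy1⟩, hn, hy1]
    norm_num

end StarSet

end Summit.CriticalPhenomena.PercolationContinuityZ3.Theorems
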